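import Mathlib.Probability.Kernel.Composition.MeasureComp
import Mathlib.Probability.Kernel.Basic
import Mathlib.MeasureTheory.Measure.GiryMonad
import Mathlib.MeasureTheory.Measure.WithDensity
import Mathlib.MeasureTheory.Measure.Prod
import Mathlib.MeasureTheory.Integral.Bochner.Basic
import HarnessLib

/-!
# Crux `FluctuationComparisonRegPrIntL` (stmt-QuantumFields-20520, rung R3), PATH-B organ — THE σ ∕ CHART JUNCTION (LIN knit step 2, LEAD w3 g25):
# a Markov disintegration `σ` of `m` along `d` and a product CHART `(Z, τ, Φ, J)` of `m|_S` over `μX` integrate every `g ≥ 0` alike, fibrewise a.e.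

Cell `ym3-torus` (YM ladder rung R3 = continuum `SU(2)` Yang–Mills on the three-torus — a RUNG: NOT d = 4, NOT infinite volume, NOT a mass gap, NOT Clay).
LEAD-20520 width seat `ym-ust-20520-w3` (gen 25), helper on crux 20520 (`--supports`, count-neutral, DEF-FREE, default heartbeats).

WHAT.  Data: a measure `m` on `Y`, a measurable `d : Y → X`, a Markov kernel `σ : X → Y` disintegrating `m` along `d` (`(m.map d).bind σ = m`,
fibre support a.e.) whose base `m.map d` has a density `r` w.r.t. a σ-finite `μX`; and a CHART: `Φ : X × Z → Y`, `J : X × Z → ℝ≥0` measurable, `τ`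
s-finite on `Z`, `S ⊆ Y` measurable, with `m.restrict (d⁻¹A ∩ S) = (((μX.restrict A).prod τ).withDensity J).map Φ` for every measurable `A`
(SpreadFibreLawH v0.3 conjunct [6]).  ★`ae_lintegral_sigma_eq_chart`: for every measurable `g : Y → ℝ≥0∞`, for `μX`-a.e. `V`,
`r V · ∫⁻_{S} g ∂(σ V) = ∫⁻ g(Φ(V,z))·J(V,z) ∂τ`.  (The LIN knit uses it twice — numerator and mass of the fibre mean — so the unknown density `r`
CANCELS in the ratio: the σ-version `mfun` of LINᵘ-H equals the chart fibre mean `∫ h(Φ(V,z))·ŵ₀(V,z) dτ` a.e., then everywhere on the window by continuity.)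

HONEST FRAMING: measure-theoretic plumbing ([folklore]: bind∕Tonelli∕`withDensity`∕`map` bookkeeping and `ae_eq_of_forall_setLIntegral_eq_of_sigmaFinite`);
nothing of Bałaban's analysis is asserted or proved; `SpreadFibreLawH` ∕ LINᵘ-H ∕ O1ᵘ-H ∕ S1aᴴ ∕ S2α′ ∕ S2β ∕ 26243 OPEN; crux 20520 `FluctuationComparisonRegPrIntL` ∕
`YM3TorusSU2` NOT proved; registry untouched; rung R3 = SU(2) YM₃ on T³ at fixed lattice data — NOT d = 4, NOT infinite volume, NOT a mass gap, NOT Clay;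
the Yang–Mills mass gap is NOT proved.
-/

set_option autoImplicit false

noncomputable section

namespace Summit.QuantumFields.YangMills.Theorems.OrganTangentSigmaChartJunction

open MeasureTheory ProbabilityTheory
open scoped ENNReal NNReal

variable {X Y Z : Type*} [MeasurableSpace X] [MeasurableSpace Y] [MeasurableSpace Z]

/-- The disintegration side, integrated over a base set: `∫⁻_A r·(∫⁻_S g ∂σV) ∂μX = ∫⁻_{d⁻¹A ∩ S} g ∂m`. [folklore] -/
theorem setLIntegral_density_mul_kernel (m : Measure Y) (μX : Measure X) {d : Y → X} (hd : Measurable d)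
    (σ : Kernel X Y) [IsSFiniteKernel σ]
    (hbind : (m.map d).bind ⇑σ = m) (hfib : ∀ᵐ V ∂(m.map d), ∀ᵐ U ∂(σ V), d U = V)
    {r : X → ℝ≥0∞} (hr : Measurable r) (hmap : m.map d = μX.withDensity r)
    {S : Set Y} (hS : MeasurableSet S) {g : Y → ℝ≥0∞} (hg : Measurable g) {A : Set X} (hA : MeasurableSet A) :
    ∫⁻ V in A, r V * ∫⁻ U in S, g U ∂(σ V) ∂μX = ∫⁻ U in d ⁻¹' A ∩ S, g U ∂m := by
  have hF : Measurable fun V => ∫⁻ U in S, g U ∂(σ V) := by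
    have : (fun V => ∫⁻ U in S, g U ∂(σ V)) = fun V => ∫⁻ U, g U ∂(Kernel.restrict σ hS V) := by
      funext V; rw [Kernel.restrict_apply]
    rw [this]; exact Measurable.lintegral_kernel hg
  -- move the density into the measure, then onto `m.map d`
  have hFA : Measurable fun V => A.indicator (fun V => ∫⁻ U in S, g U ∂(σ V)) V := hF.indicator hA
  have step1 : ∫⁻ V in A, r V * ∫⁻ U in S, g U ∂(σ V) ∂μX = ∫⁻ V, A.indicator (fun V => ∫⁻ U in S, g U ∂(σ V)) V ∂(m.map d) := by
    rw [hmap, lintegral_withDensity_eq_lintegral_mul μX hr hFA, ← lintegral_indicator hA]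
    refine lintegral_congr fun V => ?_
    by_cases hV : V ∈ A <;> simp [hV]
  rw [step1]
  -- the inner integrand as a function on `Y`, using the fibre support
  have hG : Measurable fun U => (d ⁻¹' A ∩ S).indicator g U := hg.indicator ((hd hA).inter hS)
  have hinner : ∀ᵐ V ∂(m.map d), A.indicator (fun V => ∫⁻ U in S, g U ∂(σ V)) V = ∫⁻ U, (d ⁻¹' A ∩ S).indicator g U ∂(σ V) := by
    filter_upwards [hfib] with V hV
    by_cases hVA : V ∈ A
    · rw [Set.indicator_of_mem hVA, ← lintegral_indicator hS]
      refine lintegral_congr_ae ?_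
      filter_upwards [hV] with U hU
      by_cases hUS : U ∈ S
      · have hUA : U ∈ d ⁻¹' A := by rw [Set.mem_preimage, hU]; exact hVA
        rw [Set.indicator_of_mem hUS, Set.indicator_of_mem (Set.mem_inter hUA hUS)]
      · rw [Set.indicator_of_notMem hUS, Set.indicator_of_notMem (fun h => hUS h.2)]
    · rw [Set.indicator_of_notMem hVA]
      refine Eq.symm ((lintegral_congr_ae ?_).trans lintegral_zero)
      filter_upwards [hV] with U hU
      have hUA : U ∉ d ⁻¹' A := by rw [Set.mem_preimage, hU]; exact hVA
      rw [Set.indicator_of_notMem (fun h => hUA h.1)]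
  rw [lintegral_congr_ae hinner, ← Measure.lintegral_bind σ.measurable.aemeasurable hG.aemeasurable, hbind,
    lintegral_indicator ((hd hA).inter hS)]

/-- The chart side, integrated over a base set: `∫⁻_A ∫⁻ g(Φ(V,z))·J(V,z) ∂τ ∂μX = ∫⁻ g ∂((((μX|A).prod τ).withDensity J).map Φ)`. [folklore] -/
theorem setLIntegral_chart (μX : Measure X) [SFinite μX] (τ : Measure Z) [SFinite τ]
    {Φ : X × Z → Y} (hΦ : Measurable Φ) {J : X × Z → ℝ≥0} (hJ : Measurable J)
    {g : Y → ℝ≥0∞} (hg : Measurable g) (A : Set X) :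
    ∫⁻ V in A, ∫⁻ z, g (Φ (V, z)) * (J (V, z) : ℝ≥0∞) ∂τ ∂μX
      = ∫⁻ U, g U ∂((((μX.restrict A).prod τ).withDensity (fun p => (J p : ℝ≥0∞))).map Φ) := by
  have hJ' : Measurable fun p : X × Z => (J p : ℝ≥0∞) := hJ.coe_nnreal_ennreal
  have hgΦ : Measurable fun p : X × Z => g (Φ p) := hg.comp hΦ
  rw [lintegral_map hg hΦ, lintegral_withDensity_eq_lintegral_mul _ hJ' hgΦ,
    lintegral_prod _ ((hJ'.mul hgΦ).aemeasurable)]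
  refine lintegral_congr fun V => lintegral_congr fun z => ?_
  simp only [Pi.mul_apply, mul_comm]

/-- ★ **THE σ ∕ CHART JUNCTION**: for every measurable `g ≥ 0`, `r V · ∫⁻_S g ∂(σ V) = ∫⁻ g(Φ(V,z))·J(V,z) ∂τ` for `μX`-a.e. `V`. [folklore] -/
theorem ae_lintegral_sigma_eq_chart (m : Measure Y) (μX : Measure X) [SigmaFinite μX] (τ : Measure Z) [SFinite τ]
    {d : Y → X} (hd : Measurable d) (σ : Kernel X Y) [IsSFiniteKernel σ]
    (hbind : (m.map d).bind ⇑σ = m) (hfib : ∀ᵐ V ∂(m.map d), ∀ᵐ U ∂(σ V), d U = V)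
    {r : X → ℝ≥0∞} (hr : Measurable r) (hmap : m.map d = μX.withDensity r)
    {Φ : X × Z → Y} (hΦ : Measurable Φ) {J : X × Z → ℝ≥0} (hJ : Measurable J) {S : Set Y} (hS : MeasurableSet S)
    (hdis : ∀ A : Set X, MeasurableSet A →
      m.restrict (d ⁻¹' A ∩ S) = ((((μX.restrict A).prod τ).withDensity (fun p => (J p : ℝ≥0∞))).map Φ))
    {g : Y → ℝ≥0∞} (hg : Measurable g) :
    ∀ᵐ V ∂μX, r V * ∫⁻ U in S, g U ∂(σ V) = ∫⁻ z, g (Φ (V, z)) * (J (V, z) : ℝ≥0∞) ∂τ := by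
  have hF : Measurable fun V => ∫⁻ U in S, g U ∂(σ V) := by
    have : (fun V => ∫⁻ U in S, g U ∂(σ V)) = fun V => ∫⁻ U, g U ∂(Kernel.restrict σ hS V) := by
      funext V; rw [Kernel.restrict_apply]
    rw [this]; exact Measurable.lintegral_kernel hg
  have hJ' : Measurable fun p : X × Z => (J p : ℝ≥0∞) := hJ.coe_nnreal_ennreal
  have hR : Measurable fun V => ∫⁻ z, g (Φ (V, z)) * (J (V, z) : ℝ≥0∞) ∂τ :=
    ((hg.comp hΦ).mul hJ').lintegral_prod_right'
  refine ae_eq_of_forall_setLIntegral_eq_of_sigmaFinite (hr.mul hF) hR fun A hA _ => ?_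
  rw [setLIntegral_density_mul_kernel m μX hd σ hbind hfib hr hmap hS hg hA, setLIntegral_chart μX τ hΦ hJ hg A,
    ← hdis A hA]

/-- Bounded measurable real functions are integrable under a finite measure (local helper). [folklore] -/
theorem integrable_of_bounded {Ω : Type*} [MeasurableSpace Ω] (P : Measure Ω) [IsFiniteMeasure P] {f : Ω → ℝ}
    (hf : Measurable f) {M : ℝ} (hM : ∀ x, |f x| ≤ M) : Integrable f P :=
  Integrable.mono' (integrable_const M) hf.aestronglyMeasurable
    (Filter.Eventually.of_forall fun x => by rw [Real.norm_eq_abs]; exact hM x)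

/-- ★ **REAL EDITION** for a bounded measurable `f` vanishing off `S` and a real density `r`: for `μX`-a.e. `V`,
`r V · ∫ f ∂(σ V) = ∫ f(Φ(V,z))·J(V,z) ∂τ`, and the chart integrand is `τ`-integrable. [folklore] -/
theorem ae_integral_sigma_eq_chart (m : Measure Y) (μX : Measure X) [SigmaFinite μX] (τ : Measure Z) [SFinite τ]
    {d : Y → X} (hd : Measurable d) (σ : Kernel X Y) [IsMarkovKernel σ]
    (hbind : (m.map d).bind ⇑σ = m) (hfib : ∀ᵐ V ∂(m.map d), ∀ᵐ U ∂(σ V), d U = V)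
    {r : X → ℝ≥0} (hr : Measurable r) (hmap : m.map d = μX.withDensity (fun V => (r V : ℝ≥0∞)))
    {Φ : X × Z → Y} (hΦ : Measurable Φ) {J : X × Z → ℝ≥0} (hJ : Measurable J) {S : Set Y} (hS : MeasurableSet S)
    (hdis : ∀ A : Set X, MeasurableSet A →
      m.restrict (d ⁻¹' A ∩ S) = ((((μX.restrict A).prod τ).withDensity (fun p => (J p : ℝ≥0∞))).map Φ))
    {f : Y → ℝ} (hf : Measurable f) (hfS : ∀ U, U ∉ S → f U = 0) {M : ℝ} (hfM : ∀ U, |f U| ≤ M) :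
    ∀ᵐ V ∂μX, Integrable (fun z => f (Φ (V, z)) * (J (V, z) : ℝ)) τ ∧
      (r V : ℝ) * ∫ U, f U ∂(σ V) = ∫ z, f (Φ (V, z)) * (J (V, z) : ℝ) ∂τ := by
  have hr' : Measurable fun V => (r V : ℝ≥0∞) := hr.coe_nnreal_ennreal
  have hp : Measurable fun U => ENNReal.ofReal (f U) := hf.ennreal_ofReal
  have hn : Measurable fun U => ENNReal.ofReal (-f U) := hf.neg.ennreal_ofReal
  have ha : Measurable fun U => ENNReal.ofReal |f U| := (continuous_abs.measurable.comp hf).ennreal_ofReal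
  have e1 := ae_lintegral_sigma_eq_chart m μX τ hd σ hbind hfib hr' hmap hΦ hJ hS hdis hp
  have e2 := ae_lintegral_sigma_eq_chart m μX τ hd σ hbind hfib hr' hmap hΦ hJ hS hdis hn
  have e3 := ae_lintegral_sigma_eq_chart m μX τ hd σ hbind hfib hr' hmap hΦ hJ hS hdis ha
  filter_upwards [e1, e2, e3] with V h1 h2 h3
  -- `f` vanishes off `S`: the restricted lintegrals are full lintegrals
  have hoff : ∀ (φ : ℝ → ℝ≥0∞), φ 0 = 0 → ∫⁻ U in S, φ (f U) ∂(σ V) = ∫⁻ U, φ (f U) ∂(σ V) := by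
    intro φ hφ
    rw [← lintegral_indicator hS]
    refine lintegral_congr fun U => ?_
    by_cases hU : U ∈ S
    · rw [Set.indicator_of_mem hU]
    · rw [Set.indicator_of_notMem hU, hfS U hU, hφ]
  rw [hoff (fun x => ENNReal.ofReal x) (by simp)] at h1
  rw [hoff (fun x => ENNReal.ofReal (-x)) (by simp)] at h2
  rw [hoff (fun x => ENNReal.ofReal |x|) (by simp)] at h3
  -- integrability on both sides
  have hfi : Integrable f (σ V) := integrable_of_bounded (σ V) hf hfM
  have hJm : Measurable fun z => (J (V, z) : ℝ) := (hJ.comp (measurable_const.prodMk measurable_id)).coe_nnreal_real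
  have hgm : Measurable fun z => f (Φ (V, z)) * (J (V, z) : ℝ) := (hf.comp (hΦ.comp (measurable_const.prodMk measurable_id))).mul hJm
  have hbd : ∫⁻ U, ENNReal.ofReal |f U| ∂(σ V) ≤ ENNReal.ofReal M := by
    calc ∫⁻ U, ENNReal.ofReal |f U| ∂(σ V) ≤ ∫⁻ _U, ENNReal.ofReal M ∂(σ V) := lintegral_mono fun U => ENNReal.ofReal_le_ofReal (hfM U)
      _ = ENNReal.ofReal M := by rw [lintegral_const, measure_univ, mul_one]
  have hgi : Integrable (fun z => f (Φ (V, z)) * (J (V, z) : ℝ)) τ := by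
    refine ⟨hgm.aestronglyMeasurable, ?_⟩
    rw [hasFiniteIntegral_iff_norm]
    have : ∀ z, ENNReal.ofReal ‖f (Φ (V, z)) * (J (V, z) : ℝ)‖ = ENNReal.ofReal |f (Φ (V, z))| * (J (V, z) : ℝ≥0∞) := by
      intro z
      rw [Real.norm_eq_abs, abs_mul, abs_of_nonneg (NNReal.coe_nonneg _), ENNReal.ofReal_mul (abs_nonneg _),
        ENNReal.ofReal_coe_nnreal]
    simp_rw [this]
    rw [← h3]
    exact ENNReal.mul_lt_top ENNReal.coe_lt_top (lt_of_le_of_lt hbd ENNReal.ofReal_lt_top)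
  refine ⟨hgi, ?_⟩
  -- both real integrals as differences of lintegrals of positive and negative parts
  rw [integral_eq_lintegral_pos_part_sub_lintegral_neg_part hfi,
    integral_eq_lintegral_pos_part_sub_lintegral_neg_part hgi]
  have hP : ∀ z, ENNReal.ofReal (f (Φ (V, z)) * (J (V, z) : ℝ)) = ENNReal.ofReal (f (Φ (V, z))) * (J (V, z) : ℝ≥0∞) := by
    intro z; rw [ENNReal.ofReal_mul' (NNReal.coe_nonneg _), ENNReal.ofReal_coe_nnreal]
  have hN : ∀ z, ENNReal.ofReal (-(f (Φ (V, z)) * (J (V, z) : ℝ))) = ENNReal.ofReal (-f (Φ (V, z))) * (J (V, z) : ℝ≥0∞) := by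
    intro z; rw [← neg_mul, ENNReal.ofReal_mul' (NNReal.coe_nonneg _), ENNReal.ofReal_coe_nnreal]
  simp_rw [hP, hN]
  rw [← h1, ← h2, ENNReal.toReal_mul, ENNReal.toReal_mul, ENNReal.coe_toReal, mul_sub]

end Summit.QuantumFields.YangMills.Theorems.OrganTangentSigmaChartJunction

end
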